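import Mathlib
import Literature.Computability.AlgebraicComplexity.NewtonPolygonTauProductBounds
import Summits.ValiantsHypothesis.ValiantsHypothesis.Theorems.NewtonUnitEquationsDissociatedUniformTotalsLaw
import Summits.ValiantsHypothesis.ValiantsHypothesis.Theorems.NewtonUnitEquationsDissociatedUniformTotalsLawUnion
import Summits.ValiantsHypothesis.ValiantsHypothesis.Theorems.NewtonUnitEquationsDissociatedUniformTotalsLawIntervalUnion
import Summits.ValiantsHypothesis.ValiantsHypothesis.Theorems.NewtonUnitEquationsDissociatedUniformTotalsLawIntervalUnionLog
import Summits.ValiantsHypothesis.ValiantsHypothesis.Theorems.NewtonUnitEquationsDissociatedUniformTotalsLawBoxWindows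
import HarnessLib

/-!
# Crux `NewtonUnitEquations.DissociatedUniform` (stmt-ValiantsHypothesis-5905): the `n = 3` totals law — the BOX STRATUM
# (rank-two Bohr sets: `#vert conv U_s(I₁ × I₂) = O(|G| log |G|)` pointwise in a product of two cyclic groups, arbitrary pairs)

Memo `Cruxes/DissociatedUniform/NOTES-t1g17.md` §4.  The next structured stratum after intervals (memo `NOTES-t1g16.md` §6(v)): label
group `G = ℤ/q₁ × ℤ/q₂`, position set a BOX `Z = [t₁, t₁+m₁) × [t₂, t₂+m₂)` (`cycBox`), arbitrary `a b : G → ℝ²`.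
* `mem_cycInterval_iff_window` — the one-dimensional window identity of `…IntervalUnionLog` (`winStart`) as a membership lemma;
* `unionPts_cycBox_eq` — `U_s(Z) = ⋃_x (a x + b''[box_x])` for the doubly periodic family `b'' (n₁, n₂) = b (n₁, n₂)` and box windows of
  shape `m₁ × m₂` with corners `(winStart t₁ m₁ s₁ x₁, winStart t₂ m₂ s₂ x₂) < (q₁, q₂)`;
* hence, by `…BoxWindows.ncard_extremePoints_boxWindows_le` (block decomposition into dominance sums, `…Dominance`):
  **`unionVert_cycBox_le`**: `#vert conv U_s(Z) ≤ 80 · K · |G|` with `K = Nat.size((2|G|+2)(q₁+1)) = O(log |G|)`, for every box,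
  every class and every pair — POINTWISE (recall pointwise bounds fail for general `Z`, `…UnionVertLower`: `Θ(|G|^{4/3})`);
  `unionTotal_cycBox_le` (`≤ 80K|G|²`);
* the `n = 3` law on the stratum of BOX-VALUED third curves: if every level set of `c` is a box and `c` takes `≤ k` values,
  `classVert ≤ 80kK|G|` pointwise and **`totalVert ≤ 80kK|G|²`** (`classVert_le_of_box_levels`, `totalVert_le_of_box_levels`).
The logarithm comes from the segment-tree decomposition of `…Dominance`; whether it is needed is open.  Honest label: a stratum theorem
up to `log`; `UnionTotalsLaw C`, `TotalsLawThree C` remain OPEN and are asserted nowhere; nothing here bears on VP ≠ VNP.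
[folklore]
-/

set_option linter.dupNamespace false -- `ValiantsHypothesis.ValiantsHypothesis` (summit = problem) in every name

open Matrix Finset
open scoped BigOperators Pointwise

namespace Summit.ValiantsHypothesis.ValiantsHypothesis.Theorems.NewtonUnitEquationsDissociatedUniform

namespace TotalsLaw

open Literature.Computability.AlgebraicComplexity.KPTT.PlanarMinkowski

section OneDim

variable {q : ℕ} [NeZero q]

/-- **Window identity, membership form**: `s − x − y ∈ [t, t+m)` iff `y` is the residue of some `n ∈ [σ, σ+m)`,
`σ = winStart t m s x`. [folklore] -/
theorem mem_cycInterval_iff_window (t m : ℕ) (s x y : ZMod q) :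
    s - x - y ∈ cycInterval q t m ↔ ∃ n : ℕ, winStart t m s x ≤ n ∧ n < winStart t m s x + m ∧ (n : ZMod q) = y := by
  constructor
  · intro hZ
    rw [cycInterval, Finset.mem_image] at hZ
    obtain ⟨i, hi, hiy⟩ := hZ; rw [Finset.mem_range] at hi
    refine ⟨winStart t m s x + (m - 1 - i), Nat.le_add_right _ _, by omega, ?_⟩
    have hy : y = s - x - ((t + i : ℕ) : ZMod q) := by rw [hiy]; abel
    rw [hy, Nat.cast_add, winStart, ZMod.natCast_zmod_val, Nat.cast_sub (by omega : i ≤ m - 1)]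
    push_cast
    ring
  · rintro ⟨n, hn1, hn2, rfl⟩
    rw [cycInterval, Finset.mem_image]
    set σ := winStart t m s x with hσdef
    refine ⟨m - 1 - (n - σ), Finset.mem_range.2 (by omega), ?_⟩
    have hσ : ((σ : ℕ) : ZMod q) = s - x - (t : ZMod q) - ((m - 1 : ℕ) : ZMod q) := by
      rw [hσdef]; unfold winStart; exact ZMod.natCast_zmod_val _
    have hn_eq : ((n : ℕ) : ZMod q) = ((σ : ℕ) : ZMod q) + ((n - σ : ℕ) : ZMod q) := by
      rw [← Nat.cast_add]; congr 1; omega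
    have hi : ((m - 1 - (n - σ) : ℕ) : ZMod q) = ((m - 1 : ℕ) : ZMod q) - ((n - σ : ℕ) : ZMod q) :=
      Nat.cast_sub (by omega)
    rw [Nat.cast_add, hi, hn_eq, hσ]
    ring

end OneDim

section Box

variable {q₁ q₂ : ℕ} [NeZero q₁] [NeZero q₂]

/-- The BOX `[t₁, t₁+m₁) × [t₂, t₂+m₂)` in `ℤ/q₁ × ℤ/q₂` (a rank-two Bohr set / product of cyclic windows). -/
def cycBox (q₁ q₂ t₁ t₂ m₁ m₂ : ℕ) : Finset (ZMod q₁ × ZMod q₂) := cycInterval q₁ t₁ m₁ ×ˢ cycInterval q₂ t₂ m₂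

/-- **The fibre union over a box is a union of translated box windows** of the doubly periodic family `(n₁, n₂) ↦ b (n₁, n₂)`.
[folklore] -/
theorem unionPts_cycBox_eq (a b : ZMod q₁ × ZMod q₂ → (Fin 2 → ℝ)) (t₁ t₂ m₁ m₂ : ℕ) (s : ZMod q₁ × ZMod q₂) :
    unionPts a b (cycBox q₁ q₂ t₁ t₂ m₁ m₂ : Set (ZMod q₁ × ZMod q₂)) s =
      ⋃ x : ZMod q₁ × ZMod q₂, (a x +ᵥ ((fun n : ℕ × ℕ => b ((n.1 : ZMod q₁), (n.2 : ZMod q₂))) ''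
        (Set.Ico (winStart t₁ m₁ s.1 x.1) (winStart t₁ m₁ s.1 x.1 + m₁) ×ˢ
          Set.Ico (winStart t₂ m₂ s.2 x.2) (winStart t₂ m₂ s.2 x.2 + m₂)))) := by
  ext p
  rw [mem_unionPts]; simp only [Set.mem_iUnion]
  constructor
  · rintro ⟨x, y, hZ, rfl⟩
    rw [Finset.mem_coe, cycBox, Finset.mem_product] at hZ
    obtain ⟨h1, h2⟩ := hZ
    rw [Prod.fst_sub, Prod.fst_sub, mem_cycInterval_iff_window] at h1
    rw [Prod.snd_sub, Prod.snd_sub, mem_cycInterval_iff_window] at h2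
    obtain ⟨n₁, hn1a, hn1b, hy1⟩ := h1
    obtain ⟨n₂, hn2a, hn2b, hy2⟩ := h2
    refine ⟨x, ?_⟩
    rw [Set.mem_vadd_set]
    refine ⟨b y, ⟨(n₁, n₂), ⟨⟨hn1a, hn1b⟩, hn2a, hn2b⟩, ?_⟩, vadd_eq_add _ _⟩
    show b (((n₁ : ℕ) : ZMod q₁), ((n₂ : ℕ) : ZMod q₂)) = b y
    rw [hy1, hy2]
  · rintro ⟨x, hp⟩
    rw [Set.mem_vadd_set] at hp
    obtain ⟨z, ⟨⟨n₁, n₂⟩, ⟨⟨hn1a, hn1b⟩, hn2a, hn2b⟩, rfl⟩, rfl⟩ := hp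
    refine ⟨x, ((n₁ : ZMod q₁), (n₂ : ZMod q₂)), ?_, vadd_eq_add _ _⟩
    rw [Finset.mem_coe, cycBox, Finset.mem_product]
    constructor
    · rw [Prod.fst_sub, Prod.fst_sub, mem_cycInterval_iff_window]; exact ⟨n₁, hn1a, hn1b, rfl⟩
    · rw [Prod.snd_sub, Prod.snd_sub, mem_cycInterval_iff_window]; exact ⟨n₂, hn2a, hn2b, rfl⟩

/-- The raw box bound: `#vert conv U_s(box) ≤ 16K(|G| + m₁m₂(q₁/m₁+1)(q₂/m₂+1))`, `K = Nat.size((2|G|+2)(m₁+1))`, for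
`m₁, m₂ ≥ 1`. [folklore] -/
theorem unionVert_cycBox_le_raw (a b : ZMod q₁ × ZMod q₂ → (Fin 2 → ℝ)) (t₁ t₂ : ℕ) {m₁ m₂ : ℕ} (hm₁ : 0 < m₁) (hm₂ : 0 < m₂)
    (s : ZMod q₁ × ZMod q₂) :
    unionVert a b (cycBox q₁ q₂ t₁ t₂ m₁ m₂ : Set (ZMod q₁ × ZMod q₂)) s ≤
      16 * Nat.size ((2 * (q₁ * q₂) + 2) * (m₁ + 1)) * (q₁ * q₂ + m₁ * m₂ * ((q₁ / m₁ + 1) * (q₂ / m₂ + 1))) := by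
  unfold unionVert
  rw [unionPts_cycBox_eq]
  have h := BoxWin.ncard_extremePoints_boxWindows_le (fun n : ℕ × ℕ => b ((n.1 : ZMod q₁), (n.2 : ZMod q₂))) a
    (fun x : ZMod q₁ × ZMod q₂ => winStart t₁ m₁ s.1 x.1) (fun x => winStart t₂ m₂ s.2 x.2) hm₁ hm₂ q₁ q₂
    (fun x => winStart_lt t₁ m₁ s.1 x.1) (fun x => winStart_lt t₂ m₂ s.2 x.2)
  have hcard : Fintype.card (ZMod q₁ × ZMod q₂) = q₁ * q₂ := by rw [Fintype.card_prod, ZMod.card, ZMod.card]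
  rw [hcard] at h
  exact h

/-- **THE BOX UNION BOUND, pointwise, up to `log`:** for all `a b : ℤ/q₁ × ℤ/q₂ → ℝ²`, every box `Z` and every class `s`,
`#vert conv U_s(Z) ≤ 80 · Nat.size((2|G|+2)(q₁+1)) · |G|` (`|G| = q₁q₂`). [folklore] -/
theorem unionVert_cycBox_le (a b : ZMod q₁ × ZMod q₂ → (Fin 2 → ℝ)) (t₁ t₂ m₁ m₂ : ℕ) (s : ZMod q₁ × ZMod q₂) :
    unionVert a b (cycBox q₁ q₂ t₁ t₂ m₁ m₂ : Set (ZMod q₁ × ZMod q₂)) s ≤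
      80 * Nat.size ((2 * (q₁ * q₂) + 2) * (q₁ + 1)) * (q₁ * q₂) := by
  classical
  have hq₁ : 0 < q₁ := Nat.pos_of_ne_zero (NeZero.ne q₁)
  have hq₂ : 0 < q₂ := Nat.pos_of_ne_zero (NeZero.ne q₂)
  -- empty windows
  by_cases h0 : m₁ = 0 ∨ m₂ = 0
  · have hempty : cycBox q₁ q₂ t₁ t₂ m₁ m₂ = ∅ := by
      rcases h0 with h | h <;> simp [cycBox, cycInterval, h]
    unfold unionVert
    rw [hempty, Finset.coe_empty]
    have : unionPts a b (∅ : Set (ZMod q₁ × ZMod q₂)) s = ∅ := by simp [unionPts]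
    rw [this, convexHull_empty]
    simp
  push Not at h0
  obtain ⟨hm₁, hm₂⟩ := h0
  -- reduce to windows of length `≤ q`
  wlog hle₁ : m₁ ≤ q₁ generalizing m₁
  · have h := this q₁ (NeZero.ne q₁) le_rfl
    have e : cycBox q₁ q₂ t₁ t₂ m₁ m₂ = cycBox q₁ q₂ t₁ t₂ q₁ m₂ := by
      rw [cycBox, cycBox, cycInterval_eq_univ_of_le t₁ (le_of_not_ge hle₁), cycInterval_eq_univ_of_le t₁ le_rfl]
    rwa [e]
  wlog hle₂ : m₂ ≤ q₂ generalizing m₂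
  · have h := this q₂ (NeZero.ne q₂) le_rfl
    have e : cycBox q₁ q₂ t₁ t₂ m₁ m₂ = cycBox q₁ q₂ t₁ t₂ m₁ q₂ := by
      rw [cycBox, cycBox, cycInterval_eq_univ_of_le t₂ (le_of_not_ge hle₂), cycInterval_eq_univ_of_le t₂ le_rfl]
    rwa [e]
  have hraw := unionVert_cycBox_le_raw a b t₁ t₂ (Nat.pos_of_ne_zero hm₁) (Nat.pos_of_ne_zero hm₂) s
  -- `K` is monotone in `m₁ ≤ q₁`
  have hK : Nat.size ((2 * (q₁ * q₂) + 2) * (m₁ + 1)) ≤ Nat.size ((2 * (q₁ * q₂) + 2) * (q₁ + 1)) :=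
    Nat.size_le_size (Nat.mul_le_mul_left _ (by omega))
  -- the area term: `m₁m₂(q₁/m₁+1)(q₂/m₂+1) ≤ (q₁+m₁)(q₂+m₂) ≤ 4 q₁ q₂`
  have h1 : m₁ * (q₁ / m₁ + 1) ≤ 2 * q₁ := by
    have := Nat.mul_div_le q₁ m₁; rw [Nat.mul_comm] at this; nlinarith
  have h2 : m₂ * (q₂ / m₂ + 1) ≤ 2 * q₂ := by
    have := Nat.mul_div_le q₂ m₂; rw [Nat.mul_comm] at this; nlinarith
  have harea : m₁ * m₂ * ((q₁ / m₁ + 1) * (q₂ / m₂ + 1)) ≤ 4 * (q₁ * q₂) := by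
    calc m₁ * m₂ * ((q₁ / m₁ + 1) * (q₂ / m₂ + 1)) = (m₁ * (q₁ / m₁ + 1)) * (m₂ * (q₂ / m₂ + 1)) := by ring
      _ ≤ (2 * q₁) * (2 * q₂) := Nat.mul_le_mul h1 h2
      _ = 4 * (q₁ * q₂) := by ring
  calc unionVert a b (cycBox q₁ q₂ t₁ t₂ m₁ m₂ : Set (ZMod q₁ × ZMod q₂)) s
      ≤ 16 * Nat.size ((2 * (q₁ * q₂) + 2) * (m₁ + 1)) * (q₁ * q₂ + m₁ * m₂ * ((q₁ / m₁ + 1) * (q₂ / m₂ + 1))) := hraw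
    _ ≤ 16 * Nat.size ((2 * (q₁ * q₂) + 2) * (q₁ + 1)) * (q₁ * q₂ + 4 * (q₁ * q₂)) := by gcongr
    _ = 80 * Nat.size ((2 * (q₁ * q₂) + 2) * (q₁ + 1)) * (q₁ * q₂) := by ring

/-- **The box union TOTALS:** `∑_s #vert conv U_s(Z) ≤ 80K|G|²` for every box `Z`. [folklore] -/
theorem unionTotal_cycBox_le (a b : ZMod q₁ × ZMod q₂ → (Fin 2 → ℝ)) (t₁ t₂ m₁ m₂ : ℕ) :
    unionTotal a b (cycBox q₁ q₂ t₁ t₂ m₁ m₂ : Set (ZMod q₁ × ZMod q₂)) ≤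
      80 * Nat.size ((2 * (q₁ * q₂) + 2) * (q₁ + 1)) * (q₁ * q₂) ^ 2 := by
  unfold unionTotal
  calc ∑ s, unionVert a b (cycBox q₁ q₂ t₁ t₂ m₁ m₂ : Set (ZMod q₁ × ZMod q₂)) s
      ≤ ∑ _s : ZMod q₁ × ZMod q₂, 80 * Nat.size ((2 * (q₁ * q₂) + 2) * (q₁ + 1)) * (q₁ * q₂) :=
        Finset.sum_le_sum fun s _ => unionVert_cycBox_le a b t₁ t₂ m₁ m₂ s
    _ = _ := by rw [Finset.sum_const, Finset.card_univ, Fintype.card_prod, ZMod.card, ZMod.card, smul_eq_mul]; ring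

/-- **The `n = 3` law on BOX-VALUED third curves, pointwise, up to `log`:** if every level set of `c` is a box and `c` takes at
most `k` values, then `V_s ≤ k · 80K · |G|` for ALL `a, b`. [folklore] -/
theorem classVert_le_of_box_levels (a b c : ZMod q₁ × ZMod q₂ → (Fin 2 → ℝ)) [DecidableEq (Fin 2 → ℝ)] (k : ℕ)
    (hk : (Finset.univ.image c).card ≤ k)
    (hbox : ∀ v ∈ Finset.univ.image c, ∃ t₁ t₂ m₁ m₂ : ℕ, c ⁻¹' {v} = (cycBox q₁ q₂ t₁ t₂ m₁ m₂ : Set (ZMod q₁ × ZMod q₂)))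
    (s : ZMod q₁ × ZMod q₂) :
    classVert a b c s ≤ k * (80 * Nat.size ((2 * (q₁ * q₂) + 2) * (q₁ + 1)) * (q₁ * q₂)) := by
  refine (classVert_le_sum_unionVert a b c s).trans ?_
  calc ∑ v ∈ Finset.univ.image c, unionVert a b (c ⁻¹' {v}) s
      ≤ ∑ _v ∈ Finset.univ.image c, 80 * Nat.size ((2 * (q₁ * q₂) + 2) * (q₁ + 1)) * (q₁ * q₂) :=
        Finset.sum_le_sum fun v hv => by
          obtain ⟨t₁, t₂, m₁, m₂, h⟩ := hbox v hv
          rw [h]; exact unionVert_cycBox_le a b t₁ t₂ m₁ m₂ s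
    _ ≤ _ := by rw [Finset.sum_const, smul_eq_mul]; exact Nat.mul_le_mul_right _ hk

/-- **… and in TOTAL:** `T(a, b, c) ≤ k · 80K · |G|²` for box-valued `c` with `≤ k` values, `a, b` arbitrary. [folklore] -/
theorem totalVert_le_of_box_levels (a b c : ZMod q₁ × ZMod q₂ → (Fin 2 → ℝ)) [DecidableEq (Fin 2 → ℝ)] (k : ℕ)
    (hk : (Finset.univ.image c).card ≤ k)
    (hbox : ∀ v ∈ Finset.univ.image c, ∃ t₁ t₂ m₁ m₂ : ℕ, c ⁻¹' {v} = (cycBox q₁ q₂ t₁ t₂ m₁ m₂ : Set (ZMod q₁ × ZMod q₂))) :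
    totalVert a b c ≤ k * (80 * Nat.size ((2 * (q₁ * q₂) + 2) * (q₁ + 1))) * (q₁ * q₂) ^ 2 := by
  unfold totalVert
  calc ∑ s, classVert a b c s ≤ ∑ _s : ZMod q₁ × ZMod q₂, k * (80 * Nat.size ((2 * (q₁ * q₂) + 2) * (q₁ + 1)) * (q₁ * q₂)) :=
        Finset.sum_le_sum fun s _ => classVert_le_of_box_levels a b c k hk hbox s
    _ = _ := by rw [Finset.sum_const, Finset.card_univ, Fintype.card_prod, ZMod.card, ZMod.card, smul_eq_mul]; ring

end Box

end TotalsLaw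

end Summit.ValiantsHypothesis.ValiantsHypothesis.Theorems.NewtonUnitEquationsDissociatedUniform
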